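import Summits.NavierStokesRegularity.NavierStokesRegularity.Statement
import Literature.Analysis.FluidPDE.NSViscosityRescaling
import Literature.Analysis.FluidPDE.NSLerayHopf

/-!
# The viscosity may be fixed in Clay (A): `NavierStokesRegularity` at one `ν > 0` gives it at all

Solo seat `solo-NavierStokesRegularity-informed` (new mathematics *about the summit statement*: a
normal form, not a substitute theorem). Fefferman's statement (A) — the summit
`NavierStokesRegularity = Literature.NS.NavierStokesExistenceSmoothR3` — quantifies over every
viscosity `ν > 0`. The classical scaling `u(t,x) = a v(a t, x)`, `p(t,x) = a² q(a t, x)`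
(`a = ν/μ`) carries smooth global solutions with viscosity `μ`, datum `a⁻¹ u₀` and bounded energy to
smooth global solutions with viscosity `ν = a μ`, datum `u₀` and bounded energy (energy scales by
`a²`), and the Schwartz class of data is invariant under `u₀ ↦ a⁻¹ u₀`. Hence:

* `isClassicalNSSolutionOn_viscosityChange`: the two-viscosity form of Tao's rescaling footnote for
  classical solutions on time sets (the tree's `IsClassicalNSSolutionOn.viscosityRescale_set` is the
  case `a = ν⁻¹`, target viscosity `1`; here the target viscosity `a μ` is arbitrary);
* `navierStokesRegularity_of_fixedViscosity`: Clay (A) at any single viscosity `μ > 0` implies the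
  summit;
* `navierStokesRegularity_iff_unitViscosity`: the summit is equivalent to its `ν = 1` instance — the
  form in which the literature (Tao 2013, ESS 2003, CKN 1982) states everything.

References: T. Tao, *Localisation and compactness properties of the Navier–Stokes global regularity
problem*, Anal. PDE 6 (2013) = arXiv:1108.1165, footnote 3 p. 4 [cite: Tao2011, footnote 3];
C. L. Fefferman, Clay problem description, statement (A) [cite: Fefferman2000, (A)].
-/

open scoped ContDiff ENNReal
open Laplacian MeasureTheory Set Function InnerProductSpace
open Literature.Analysis.FluidPDE

namespace Summit.NavierStokesRegularity.NavierStokesRegularity.Theorems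

noncomputable section

section General

variable {E : Type*} [NormedAddCommGroup E] [InnerProductSpace ℝ E] [FiniteDimensional ℝ E]

/-- **Change of viscosity by time dilation (two-viscosity form of Tao's footnote 3).** If `(u, p)`
is a classical solution of `∂ₜu + (u·∇)u = μΔu − ∇p + f`, `div u = 0` on `S × E`, and `s ↦ a s`
maps a set of unique differentiability `S'` into `S`, then `v(s,x) = a u(a s, x)`,
`q(s,x) = a² p(a s, x)`, `g(s,x) = a² f(a s, x)` form a classical solution with viscosity `a μ` on
`S' × E`: multiply the momentum equation at time `a s` by `a²` and use `∂ₛv = a²(∂ₜu)(a s)`,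
`(v·∇)v = a²(u·∇)u`, `Δv = aΔu`, `∇q = a²∇p`. No sign or invertibility condition on `a` is
needed for the algebra. [cite: Tao2011, footnote 3] -/
theorem isClassicalNSSolutionOn_viscosityChange {S S' : Set ℝ} {μ : ℝ} {f u : ℝ → E → E}
    {p : ℝ → E → ℝ} (h : IsClassicalNSSolutionOn S μ f u p) (a : ℝ)
    (hS' : MapsTo (fun s => a * s) S' S) (hU : UniqueDiffOn ℝ S') :
    IsClassicalNSSolutionOn S' (a * μ) (timeRescale a (a ^ 2) f) (timeRescale a a u)
      (timeRescale a (a ^ 2) p) where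
  smooth_velocity := h.smooth_velocity.timeRescale _ _ hS'
  smooth_pressure := h.smooth_pressure.timeRescale _ _ hS'
  momentum s hs x := by
    have ht : a * s ∈ S := hS' hs
    set t : ℝ := a * s with htdef
    have hmom := h.momentum t ht x
    have hu2 : ContDiff ℝ 2 (u t) := (h.contDiff_velocity ht).of_le (by norm_cast)
    have hud : DifferentiableAt ℝ (u t) x := (hu2.differentiable (by norm_num)) x
    have hpd : DifferentiableAt ℝ (p t) x :=
      ((h.contDiff_pressure ht).differentiable (by simp)) x
    have hlap : (Δ fun y => a • u t y) x = a • (Δ (u t)) x := by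
      rw [show (fun y => a • u t y) = a • u t from rfl]
      exact laplacian_smul a hu2.contDiffAt
    rw [timeDerivWithin_timeRescale h.smooth_velocity a hS' hU hs x, timeRescale_slice,
      timeRescale_slice, timeRescale_apply, convect_const_smul_const_smul hud,
      hlap, gradient_const_smul hpd, ← htdef]
    have key : (a * a) • (timeDerivWithin S u t x + convect (u t) (u t) x) =
        (a * a) • (μ • (Δ (u t)) x - gradient (p t) x + f t x) := by rw [hmom]
    rw [smul_add] at key
    rw [key, smul_add, smul_sub, smul_smul, smul_smul, sq, mul_right_comm a μ a]
  divFree s hs := by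
    rw [timeRescale_slice]
    have ht : a * s ∈ S := hS' hs
    exact (h.divFree _ ht).const_smul ((h.contDiff_velocity ht).differentiable (by simp)) _

end General

/-- **Clay (A) at one viscosity implies Clay (A).** If for some `μ > 0` every smooth, divergence-free,
rapidly decaying datum on `ℝ³` admits a global smooth solution of the unforced Navier–Stokes system
with viscosity `μ` and bounded energy, then the same holds for every `ν > 0`, i.e. the summit
`NavierStokesRegularity` holds: solve with datum `a⁻¹ u₀`, `a = ν/μ`, and rescale by
`isClassicalNSSolutionOn_viscosityChange`; the energy bound is multiplied by `a²`.
[cite: Tao2011, footnote 3] [cite: Fefferman2000, (A)] -/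
theorem navierStokesRegularity_of_fixedViscosity {μ : ℝ} (hμ : 0 < μ)
    (h : ∀ u₀ : EuclideanSpace ℝ (Fin 3) → EuclideanSpace ℝ (Fin 3), ContDiff ℝ ∞ u₀ →
      NSWave0.IsDivFree u₀ → HasRapidSpatialDecay u₀ →
      ∃ (u : ℝ → EuclideanSpace ℝ (Fin 3) → EuclideanSpace ℝ (Fin 3))
        (p : ℝ → EuclideanSpace ℝ (Fin 3) → ℝ),
        IsSmoothOnHalfSpace u ∧ IsSmoothOnHalfSpace p ∧
          IsNavierStokesSolution μ 0 u₀ u p ∧ HasBoundedEnergy u) :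
    NavierStokesRegularity := by
  intro ν hν u₀ hu₀ hdiv hdec
  -- the dilation factor: from viscosity `μ` to viscosity `a * μ = ν`
  set a : ℝ := ν / μ with ha
  have ha0 : 0 < a := div_pos hν hμ
  have haμ : a * μ = ν := div_mul_cancel₀ ν hμ.ne'
  -- the rescaled datum `a⁻¹ • u₀` is again smooth, divergence free and rapidly decaying
  have hv₀ : ContDiff ℝ ∞ (fun x => a⁻¹ • u₀ x) := hu₀.const_smul a⁻¹
  have hv₀div : NSWave0.IsDivFree (fun x => a⁻¹ • u₀ x) :=
    VectorCalculus.IsDivFree.const_smul (hu₀.differentiable (by simp)) hdiv a⁻¹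
  have hv₀dec : HasRapidSpatialDecay (fun x => a⁻¹ • u₀ x) := by
    intro n K
    obtain ⟨C, hC⟩ := hdec n K
    refine ⟨‖a⁻¹‖ * C, fun x => ?_⟩
    have hn : ContDiffAt ℝ n u₀ x := (hu₀.of_le (by exact_mod_cast le_top)).contDiffAt
    rw [iteratedFDeriv_const_smul_apply' hn, norm_smul, mul_left_comm]
    exact mul_le_mul_of_nonneg_left (hC x) (norm_nonneg _)
  -- solve with viscosity `μ`
  obtain ⟨v, q, hv, hq, hns, hE⟩ := h _ hv₀ hv₀div hv₀dec
  have hcl : IsClassicalNSSolutionOn (Ici 0) μ 0 v q ∧ v 0 = fun x => a⁻¹ • u₀ x :=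
    isNavierStokesSolution_and_smooth_iff.mp ⟨hns, hv, hq⟩
  -- rescale to viscosity `a * μ = ν`
  have hmaps : MapsTo (fun s => a * s) (Ici (0 : ℝ)) (Ici 0) := fun s hs =>
    mul_nonneg ha0.le hs
  have hcl' := isClassicalNSSolutionOn_viscosityChange hcl.1 a hmaps (uniqueDiffOn_Ici 0)
  rw [haμ, timeRescale_zero_force] at hcl'
  have h0 : timeRescale a a v 0 = u₀ := by
    funext x
    simp only [timeRescale_apply, mul_zero, hns.initial, smul_smul, mul_inv_cancel₀ ha0.ne',
      one_smul]
  obtain ⟨hns', hu', hp'⟩ := isNavierStokesSolution_and_smooth_iff.mpr ⟨hcl', h0⟩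
  refine ⟨timeRescale a a v, timeRescale a (a ^ 2) q, hu', hp', hns', ?_⟩
  -- bounded energy: `∫ |a v(a t)|² = a² ∫ |v(a t)|² ≤ a² C`
  obtain ⟨C, hC, hCb⟩ := hE
  refine ⟨ENNReal.ofReal (a ^ 2) * C, ENNReal.mul_lt_top ENNReal.ofReal_lt_top hC, fun t ht => ?_⟩
  simp only [timeRescale_apply]
  rw [lintegral_enorm_sq_const_smul]
  exact mul_le_mul_right (hCb (a * t) (mul_nonneg ha0.le ht)) _

/-- **The summit is equivalent to its unit-viscosity instance.** `NavierStokesRegularity` (Clay (A),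
all `ν > 0`) holds iff every smooth, divergence-free, rapidly decaying datum on `ℝ³` has a global
smooth bounded-energy solution of the unforced system with viscosity `1` — the normalisation under
which the literature is written. [cite: Tao2011, footnote 3] [cite: Fefferman2000, (A)] -/
theorem navierStokesRegularity_iff_unitViscosity :
    NavierStokesRegularity ↔
      ∀ u₀ : EuclideanSpace ℝ (Fin 3) → EuclideanSpace ℝ (Fin 3), ContDiff ℝ ∞ u₀ →
        NSWave0.IsDivFree u₀ → HasRapidSpatialDecay u₀ →
        ∃ (u : ℝ → EuclideanSpace ℝ (Fin 3) → EuclideanSpace ℝ (Fin 3))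
          (p : ℝ → EuclideanSpace ℝ (Fin 3) → ℝ),
          IsSmoothOnHalfSpace u ∧ IsSmoothOnHalfSpace p ∧
            IsNavierStokesSolution 1 0 u₀ u p ∧ HasBoundedEnergy u :=
  ⟨fun h => h 1 one_pos, fun h => navierStokesRegularity_of_fixedViscosity one_pos h⟩

end

end Summit.NavierStokesRegularity.NavierStokesRegularity.Theorems
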